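import Summits.BirchSwinnertonDyer.Rank1Residual.Additive.PadicLogImage
import HarnessLib

/-!
# The log-dual lattice `{a : ∀ Q, ‖a · log_ω Q‖ ≤ 1}` determines its scaling: `hdual` pins the generator
# up to a `p`-adic UNIT (cell `bsd-addord`, seat w2-kport gen 8; `--supports stmt-BirchSwinnertonDyer-19560`, helper)

HONEST FRAMING. Route W2 (`route-BirchSwinnertonDyer-KimAtThreeKolyvagin`), crux 19560
`KatoKuriharaPortThreeShared`. The crux's displayed residual hKatoFin (kim3 gen 15, `KimAtThreeFineKatoFinalCrux`)
carries `hdual(d)` («the range of `exp*_d` is the dual lattice `{a : ∀ Q ∈ E(ℚ₃), ‖a · log_ω Q‖ ≤ 1}`») and the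
position clause of w2-acc4's road (`KimAtThreeFineKatoOuterRescale.exists_dual_unit_of_position`) quantifies over
EVERY `e` with `hdual(e • d)`. acc4 landed the unit-INVARIANCE direction (`hdual_transfer_of_norm_eq_one`:
`‖w‖ = 1 ⇒ hdual(φ) → hdual(w·φ)`); kim3's residual memo (HOME/kim3/KIM3-19560-RESIDUAL-g15.md §2) names the
CONVERSE — «uniqueness of `e` up to units is a 10-line lemma NOT yet in the tree» — as an input of the (a″)/POS
derivation. THIS FILE proves that converse, abstractly: for ANY `p`-integral elliptic `X/ℚ_p`, ANY map
`φ : H → ℚ_p` and ANY scalar `w`, `hdual(φ) ∧ hdual(w·φ) ⇒ ‖w‖ = 1` (hence equal valuations for two rescalings).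
The only arithmetic input is n1011's image theorem `range_padicLog_eq_span_zpow` (`log_ω E(ℚ_p) = p^k ℤ_p`), which
makes the dual set a NONZERO BOUNDED subset of `ℚ_p`; a nonzero bounded set stable under `a ↦ c·a` in both
directions forces `‖c‖ = 1`. TOOL theorems only (no definition, no instance, no named fact, no `sorry`); closes
nothing by itself; nothing booked; BSD / 19560 are not proved by any of this.

## What is proved

* §1 (any nontrivially normed field) `norm_le_one_of_forall_mem_iff_mul_mem`, **`norm_eq_one_of_forall_mem_iff_mul_mem`**:
  a set with a nonzero element and a norm bound, satisfying `a ∈ S ↔ c·a ∈ S`, has `‖c‖ = 1`.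
* §2 (`X/ℚ_p` integral elliptic) `norm_padicLog_le_norm_zpow`, `exists_padicLog_eq_zpow`, `exists_range_padicLog_eq_span_zpow`,
  **`exists_ne_zero_forall_norm_mul_padicLog_le_one`** (the dual set has a nonzero element),
  **`exists_bound_of_forall_norm_mul_padicLog_le_one`** (the dual set is bounded).
* §3 **`norm_eq_one_of_range_iff_of_range_mul_iff`** (`hdual(φ) ∧ hdual(w·φ) ⇒ ‖w‖ = 1`),
  `norm_eq_one_of_hdual_of_hdual` (acc4's `φ' = w·φ` shape), **`norm_eq_norm_of_hdual_smul_of_hdual_smul`** and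
  **`valuation_eq_of_hdual_smul_of_hdual_smul`** (two rescalings `e₁·φ`, `e₂·φ` both duality-normalised ⇒
  `‖e₁‖ = ‖e₂‖`, `v(e₁) = v(e₂)`).

References: S. Bloch, K. Kato (1990) §3 Prop. 3.8, Ex. 3.11 [BlochKato1990]; J. H. Silverman, *AEC* (2009) IV.6.4,
VII.6.3 [SilvermanAEC2009].
-/

noncomputable section

-- the cell's Theorems namespace `Summit.BirchSwinnertonDyer.BirchSwinnertonDyer.…` repeats the summit name by design (D-0017)
set_option linter.dupNamespace false

open scoped Classical
open Summit.BirchSwinnertonDyer.Rank1Residual.Additive.LocalLog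

namespace Summit.BirchSwinnertonDyer.BirchSwinnertonDyer.Theorems.KimAtThreeFineKatoLogDualScaling

/-! ## §1 A nonzero bounded set stable under `a ↦ c·a` both ways has `‖c‖ = 1` -/

section NormedField

variable {K : Type*} [NontriviallyNormedField K] {S : Set K}

/-- If `S` has a nonzero element and a norm bound, and `a ∈ S → d·a ∈ S`, then `‖d‖ ≤ 1`
(else `dⁿ·a₀` leaves every ball). [folklore] -/
theorem norm_le_one_of_forall_mem_mul_mem (h0 : ∃ a ∈ S, a ≠ 0) (hb : ∃ C, ∀ a ∈ S, ‖a‖ ≤ C)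
    {d : K} (h : ∀ a ∈ S, d * a ∈ S) : ‖d‖ ≤ 1 := by
  obtain ⟨a₀, ha₀S, ha₀⟩ := h0
  obtain ⟨C, hC⟩ := hb
  by_contra hd
  rw [not_le] at hd
  have hpow : ∀ n : ℕ, d ^ n * a₀ ∈ S := by
    intro n
    induction n with
    | zero => simpa using ha₀S
    | succ n ih =>
      have := h _ ih
      rwa [← mul_assoc, ← pow_succ'] at this
  have ha₀pos : 0 < ‖a₀‖ := norm_pos_iff.mpr ha₀
  obtain ⟨n, hn⟩ := pow_unbounded_of_one_lt (C / ‖a₀‖) hd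
  have h1 := hC _ (hpow n)
  rw [norm_mul, norm_pow] at h1
  have h2 : C < ‖d‖ ^ n * ‖a₀‖ := (div_lt_iff₀ ha₀pos).mp hn
  exact absurd (lt_of_lt_of_le h2 h1) (lt_irrefl _)

/-- **A nonzero bounded set with `a ∈ S ↔ c·a ∈ S` has `‖c‖ = 1`.** [folklore] -/
theorem norm_eq_one_of_forall_mem_iff_mul_mem (h0 : ∃ a ∈ S, a ≠ 0) (hb : ∃ C, ∀ a ∈ S, ‖a‖ ≤ C)
    {c : K} (h : ∀ a, a ∈ S ↔ c * a ∈ S) : ‖c‖ = 1 := by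
  have hc0 : c ≠ 0 := by
    rintro rfl
    obtain ⟨a₀, ha₀S, -⟩ := h0
    obtain ⟨C, hC⟩ := hb
    have h0S : (0 : K) ∈ S := by simpa using (h a₀).mp ha₀S
    obtain ⟨b, hb'⟩ := NormedField.exists_lt_norm K C
    have hbS : b ∈ S := (h b).mpr (by simpa using h0S)
    exact absurd (hC b hbS) (not_le.mpr hb')
  refine le_antisymm (norm_le_one_of_forall_mem_mul_mem h0 hb fun a ha => (h a).mp ha) ?_
  have hinv : ‖c⁻¹‖ ≤ 1 :=
    norm_le_one_of_forall_mem_mul_mem h0 hb fun a ha => by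
      rw [h (c⁻¹ * a), mul_inv_cancel_left₀ hc0]
      exact ha
  rw [norm_inv] at hinv
  have hcpos : 0 < ‖c‖ := norm_pos_iff.mpr hc0
  exact (inv_le_one₀ hcpos).mp hinv

end NormedField

/-! ## §2 The log-dual set of an integral elliptic `X/ℚ_p` is nonzero and bounded -/

section Curve

open WeierstrassCurve

variable {p : ℕ} [Fact p.Prime] (X : WeierstrassCurve ℚ_[p]) [X.IsIntegral ℤ_[p]] [X.IsElliptic]

/-- `‖log_ω Q‖ ≤ ‖p^k‖` when `log_ω E(ℚ_p) = p^k ℤ_p`. [cite: SilvermanAEC2009, IV.6.4 and VII.6.3] -/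
theorem norm_padicLog_le_norm_zpow {k : ℤ}
    (hk : (padicLog X).range = (Submodule.span ℤ_[p] {(p : ℚ_[p]) ^ k}).toAddSubgroup)
    (Q : X.toAffine.Point) : ‖padicLog X Q‖ ≤ ‖(p : ℚ_[p]) ^ k‖ := by
  have hmem : padicLog X Q ∈ (padicLog X).range := ⟨Q, rfl⟩
  rw [hk, Submodule.mem_toAddSubgroup, Submodule.mem_span_singleton] at hmem
  obtain ⟨r, hr⟩ := hmem
  rw [← hr, Algebra.smul_def, PadicInt.algebraMap_apply, norm_mul]
  exact mul_le_of_le_one_left (norm_nonneg _) (PadicInt.norm_le_one r)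

/-- `p^k` is a value of `log_ω` when `log_ω E(ℚ_p) = p^k ℤ_p`. [cite: SilvermanAEC2009, IV.6.4 and VII.6.3] -/
theorem exists_padicLog_eq_zpow {k : ℤ}
    (hk : (padicLog X).range = (Submodule.span ℤ_[p] {(p : ℚ_[p]) ^ k}).toAddSubgroup) :
    ∃ Q : X.toAffine.Point, padicLog X Q = (p : ℚ_[p]) ^ k := by
  have hmem : (p : ℚ_[p]) ^ k ∈ (padicLog X).range := by
    rw [hk, Submodule.mem_toAddSubgroup]
    exact Submodule.subset_span rfl
  obtain ⟨Q, hQ⟩ := hmem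
  exact ⟨Q, hQ⟩

/-- `log_ω E(ℚ_p) = p^k ℤ_p` for SOME integer `k` (n1011 `range_padicLog_eq_span_zpow`, exponent hidden).
[cite: SilvermanAEC2009, IV.6.4 and VII.6.3] -/
theorem exists_range_padicLog_eq_span_zpow :
    ∃ k : ℤ, (padicLog X).range = (Submodule.span ℤ_[p] {(p : ℚ_[p]) ^ k}).toAddSubgroup :=
  ⟨_, range_padicLog_eq_span_zpow X⟩

/-- **The log-dual set `{a : ∀ Q, ‖a · log_ω Q‖ ≤ 1}` of a `p`-integral elliptic `X/ℚ_p` contains a nonzero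
element** (`log_ω E(ℚ_p) = p^k ℤ_p` is bounded, n1011 `range_padicLog_eq_span_zpow`). [cite: SilvermanAEC2009, IV.6.4 and VII.6.3] -/
theorem exists_ne_zero_forall_norm_mul_padicLog_le_one :
    ∃ a : ℚ_[p], a ≠ 0 ∧ ∀ Q : X.toAffine.Point, ‖a * padicLog X Q‖ ≤ 1 := by
  obtain ⟨k, hk⟩ := exists_range_padicLog_eq_span_zpow X
  have hp0 : (p : ℚ_[p]) ≠ 0 := natCast_p_ne_zero
  refine ⟨((p : ℚ_[p]) ^ k)⁻¹, inv_ne_zero (zpow_ne_zero k hp0), fun Q => ?_⟩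
  rw [norm_mul, norm_inv]
  have hpk : 0 < ‖(p : ℚ_[p]) ^ k‖ := norm_pos_iff.mpr (zpow_ne_zero k hp0)
  rw [inv_mul_le_iff₀ hpk, mul_one]
  exact norm_padicLog_le_norm_zpow X hk Q

/-- **The log-dual set of a `p`-integral elliptic `X/ℚ_p` is bounded** (`log_ω` takes the nonzero value `p^k`).
[cite: SilvermanAEC2009, IV.6.4 and VII.6.3] -/
theorem exists_bound_of_forall_norm_mul_padicLog_le_one :
    ∃ C : ℝ, ∀ a : ℚ_[p], (∀ Q : X.toAffine.Point, ‖a * padicLog X Q‖ ≤ 1) → ‖a‖ ≤ C := by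
  obtain ⟨k, hk⟩ := exists_range_padicLog_eq_span_zpow X
  have hp0 : (p : ℚ_[p]) ≠ 0 := natCast_p_ne_zero
  obtain ⟨Q₀, hQ₀⟩ := exists_padicLog_eq_zpow X hk
  refine ⟨‖(p : ℚ_[p]) ^ k‖⁻¹, fun a ha => ?_⟩
  have h := ha Q₀
  rw [hQ₀, norm_mul] at h
  have hpk : 0 < ‖(p : ℚ_[p]) ^ k‖ := norm_pos_iff.mpr (zpow_ne_zero k hp0)
  rwa [← le_div_iff₀ hpk, one_div] at h

/-! ## §3 `hdual` pins the scaling up to a unit -/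

/-- **`hdual(φ) ∧ hdual(w·φ) ⇒ ‖w‖ = 1`.** For ANY `p`-integral elliptic `X/ℚ_p`, ANY map `φ : H → ℚ_p` and ANY
`w ∈ ℚ_p`: if both `φ` and `w·φ` have range EQUAL to the log-dual set `{a : ∀ Q, ‖a · log_ω Q‖ ≤ 1}`, then `w` is
a `p`-adic unit (the converse of w2-acc4's `hdual_transfer_of_norm_eq_one`). [cite: BlochKato1990, §3 Prop. 3.8 and Ex. 3.11] -/
theorem norm_eq_one_of_range_iff_of_range_mul_iff {H : Sort*} (φ : H → ℚ_[p]) (w : ℚ_[p])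
    (h₁ : ∀ a : ℚ_[p], (∃ y, φ y = a) ↔ ∀ Q : X.toAffine.Point, ‖a * padicLog X Q‖ ≤ 1)
    (h₂ : ∀ a : ℚ_[p], (∃ y, w * φ y = a) ↔ ∀ Q : X.toAffine.Point, ‖a * padicLog X Q‖ ≤ 1) :
    ‖w‖ = 1 := by
  set S : Set ℚ_[p] := {a | ∀ Q : X.toAffine.Point, ‖a * padicLog X Q‖ ≤ 1} with hS
  have h0 : ∃ a ∈ S, a ≠ 0 := by
    obtain ⟨a, ha, haS⟩ := exists_ne_zero_forall_norm_mul_padicLog_le_one X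
    exact ⟨a, haS, ha⟩
  have hb : ∃ C, ∀ a ∈ S, ‖a‖ ≤ C := exists_bound_of_forall_norm_mul_padicLog_le_one X
  have hw0 : w ≠ 0 := by
    rintro rfl
    obtain ⟨a, haS, ha⟩ := h0
    obtain ⟨y, hy⟩ := (h₂ a).mpr haS
    rw [zero_mul] at hy
    exact ha hy.symm
  have key : ∀ a, a ∈ S ↔ w⁻¹ * a ∈ S := by
    intro a
    change (∀ Q, _) ↔ (∀ Q, _)
    rw [← h₂ a, ← h₁ (w⁻¹ * a)]
    constructor
    · rintro ⟨y, hy⟩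
      exact ⟨y, by rw [← hy, inv_mul_cancel_left₀ hw0]⟩
    · rintro ⟨y, hy⟩
      exact ⟨y, by rw [hy, mul_inv_cancel_left₀ hw0]⟩
  have h := norm_eq_one_of_forall_mem_iff_mul_mem h0 hb key
  rwa [norm_inv, inv_eq_one] at h

/-- **acc4's shape**: for `φ φ' : H → ℚ_p` with `φ' = w·φ` pointwise, `hdual(φ) ∧ hdual(φ') ⇒ ‖w‖ = 1` — the
converse of `KimAtThreeFineKatoOuterRescale.hdual_transfer_of_norm_eq_one`. [cite: BlochKato1990, §3 Prop. 3.8 and Ex. 3.11] -/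
theorem norm_eq_one_of_hdual_of_hdual {H : Sort*} {φ φ' : H → ℚ_[p]} {w : ℚ_[p]}
    (hφ : ∀ y, φ' y = w * φ y)
    (h₁ : ∀ a : ℚ_[p], (∃ y, φ y = a) ↔ ∀ Q : X.toAffine.Point, ‖a * padicLog X Q‖ ≤ 1)
    (h₂ : ∀ a : ℚ_[p], (∃ y, φ' y = a) ↔ ∀ Q : X.toAffine.Point, ‖a * padicLog X Q‖ ≤ 1) :
    ‖w‖ = 1 := by
  refine norm_eq_one_of_range_iff_of_range_mul_iff X φ w h₁ fun a => ?_
  rw [← h₂ a]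
  simp only [hφ]

/-- **Two duality-normalising rescalings have the same norm**: if `e₁·φ` and `e₂·φ` both have range the
log-dual set, then `‖e₁‖ = ‖e₂‖` (both are nonzero). [cite: BlochKato1990, §3 Prop. 3.8 and Ex. 3.11] -/
theorem norm_eq_norm_of_hdual_smul_of_hdual_smul {H : Sort*} (φ : H → ℚ_[p]) (e₁ e₂ : ℚ_[p])
    (h₁ : ∀ a : ℚ_[p], (∃ y, e₁ * φ y = a) ↔ ∀ Q : X.toAffine.Point, ‖a * padicLog X Q‖ ≤ 1)
    (h₂ : ∀ a : ℚ_[p], (∃ y, e₂ * φ y = a) ↔ ∀ Q : X.toAffine.Point, ‖a * padicLog X Q‖ ≤ 1) :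
    ‖e₁‖ = ‖e₂‖ := by
  have he₁ : e₁ ≠ 0 := by
    rintro rfl
    obtain ⟨a, ha, haS⟩ := exists_ne_zero_forall_norm_mul_padicLog_le_one X
    obtain ⟨y, hy⟩ := (h₁ a).mpr haS
    rw [zero_mul] at hy
    exact ha hy.symm
  have h := norm_eq_one_of_range_iff_of_range_mul_iff X (fun y => e₁ * φ y) (e₂ * e₁⁻¹) h₁ fun a => by
    rw [← h₂ a]
    simp only [mul_assoc, inv_mul_cancel_left₀ he₁]
  rw [norm_mul, norm_inv, mul_inv_eq_one₀ (norm_ne_zero_iff.mpr he₁)] at h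
  exact h.symm

/-- **Two duality-normalising rescalings have the same `p`-adic valuation** (`Padic.valuation`; the currency of
the position clause POS of `KimAtThreeFineKatoOuterRescale.exists_dual_unit_of_position`).
[cite: BlochKato1990, §3 Prop. 3.8 and Ex. 3.11] -/
theorem valuation_eq_of_hdual_smul_of_hdual_smul {H : Sort*} (φ : H → ℚ_[p]) (e₁ e₂ : ℚ_[p])
    (h₁ : ∀ a : ℚ_[p], (∃ y, e₁ * φ y = a) ↔ ∀ Q : X.toAffine.Point, ‖a * padicLog X Q‖ ≤ 1)
    (h₂ : ∀ a : ℚ_[p], (∃ y, e₂ * φ y = a) ↔ ∀ Q : X.toAffine.Point, ‖a * padicLog X Q‖ ≤ 1) :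
    e₁.valuation = e₂.valuation := by
  have hne : ∀ {e : ℚ_[p]}, (∀ a : ℚ_[p], (∃ y, e * φ y = a) ↔
      ∀ Q : X.toAffine.Point, ‖a * padicLog X Q‖ ≤ 1) → e ≠ 0 := by
    intro e he h0
    subst h0
    obtain ⟨a, ha, haS⟩ := exists_ne_zero_forall_norm_mul_padicLog_le_one X
    obtain ⟨y, hy⟩ := (he a).mpr haS
    rw [zero_mul] at hy
    exact ha hy.symm
  have h := norm_eq_norm_of_hdual_smul_of_hdual_smul X φ e₁ e₂ h₁ h₂
  rw [Padic.norm_eq_zpow_neg_valuation (hne h₁), Padic.norm_eq_zpow_neg_valuation (hne h₂)] at h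
  have hp1 : (1 : ℝ) < p := by exact_mod_cast (Fact.out : p.Prime).one_lt
  have hinj := zpow_right_injective₀ (lt_trans zero_lt_one hp1) hp1.ne' h
  simpa using hinj

end Curve

end Summit.BirchSwinnertonDyer.BirchSwinnertonDyer.Theorems.KimAtThreeFineKatoLogDualScaling

end
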